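import Literature.Probability.RandomPlanarGeometry.SLERestrictionProcesses
import HarnessLib

/-!
# The processes of [LSW] §5 along the SLE_κ driving path, `0 < κ ≤ 8/3`: general-`κ` twin of `SLERestrictionProcesses`

For a nonempty `*`-hull `A` and `κ : ℝ≥0` we set up, as measurable functionals of a continuous path
`υ ∈ C(ℝ≥0, ℝ)` (driver `W = √κ·(υ - υ 0)`, `drvK κ υ`; `SLERestrictionProcesses` is the case
`√κ = σ = √(8/3)`), the ingredients of the compensated restriction martingale
`Y_t = h_t′(W_t)^α exp(λ ∫₀ᵗ Sh_s(W_s)/6 ds)` of [LSW] Prop. 5.3 and of its localisation: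

* `RFnK` — the alive functional `aliveFn` of `SLERestrictionAlive` along the path;
* `DFnK` — `Φ'_{A_t - W_t}(0) · 𝟙{alive}`;
* `DhatFnK n = min DFnK (n · RFnK)` — a continuous (in `t`) modification agreeing with
  `Φ'_{A_t - W_t}(0)` wherever `RFnK ≥ 1/n`;

and, composing with the Brownian path `brownianCPath` (so that `drvK κ (brownianCPath ω)` is the
SLE_κ driving function `√κ B`, `drvK_brownianCPath`), the corresponding processes on the Wiener
space, adapted with continuous paths, the localising stopping times
`T_n = S_n ∧ T²_n ∧ (n+1)` (`isStoppingTime_locTimeK`), and the controlled class before `T_n`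
(`controlled_of_lt_locTimeK`). Proofs are those of `SLERestrictionProcesses`, verbatim with the
general driver (the parametrised-family lemmas of `SLERestrictionAlive*`,
`SLERestrictionDerivMeasurable` apply to any continuous drivers from `0` with measurable values).

## References

* G. F. Lawler, O. Schramm, W. Werner, *Conformal restriction: the chordal case* (2003), §5,
  Prop. 5.3 [LawlerSchrammWerner2003Restriction].
-/

noncomputable section

open Set Filter Metric Function MeasureTheory
open _root_.Complex _root_.Topology
open Literature.Probability.Process (brownian preWienerMeasure)
open scoped NNReal

namespace Literature.Probability.RandomPlanarGeometry

open Loewner PathOps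

/-! ### The driver of a path -/

/-- The driver `W = √κ (υ - υ 0)` of a continuous path. [folklore] -/
def drvK (κ : ℝ≥0) (υ : C(ℝ≥0, ℝ)) : ℝ≥0 → ℝ := fun r ↦ Real.sqrt κ * (υ r - υ 0)

/-- The driver is continuous. [folklore] -/
theorem continuous_drvK (κ : ℝ≥0) (υ : C(ℝ≥0, ℝ)) : Continuous (drvK κ υ) :=
  continuous_const.mul (υ.continuous.sub continuous_const)

/-- The driver starts at `0`. [folklore] -/
theorem drvK_zero (κ : ℝ≥0) (υ : C(ℝ≥0, ℝ)) : drvK κ υ 0 = 0 := by simp [drvK]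

/-- The driver of the Brownian path is the SLE_κ driving function `√κ B`. [folklore] -/
theorem drvK_brownianCPath (κ : ℝ≥0) (ω : ℝ≥0 → ℝ) : drvK κ (brownianCPath ω) = sleDriving κ ω := by
  funext r
  rw [sleDriving_apply]
  show Real.sqrt κ * (brownian r ω - brownian 0 ω) = Real.sqrt κ * brownian r ω
  rw [Process.brownian_zero]; simp

/-- The driver of the stopped path agrees with the driver up to the stopping time. [folklore] -/
theorem drvK_stop_of_le (κ : ℝ≥0) {s r : ℝ≥0} (υ : C(ℝ≥0, ℝ)) (hr : r ≤ s) : drvK κ (stop s υ) r = drvK κ υ r := by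
  simp [drvK, stop_apply, min_eq_left hr]

section PathMeasurable

variable [MeasurableSpace C(ℝ≥0, ℝ)] [BorelSpace C(ℝ≥0, ℝ)]

/-- The driver values are measurable functionals of the path. [folklore] -/
theorem measurable_drvK_apply (κ : ℝ≥0) (r : ℝ≥0) : Measurable fun υ : C(ℝ≥0, ℝ) ↦ drvK κ υ r :=
  measurable_const.mul ((PathOps.measurable_eval r).sub (PathOps.measurable_eval 0))

end PathMeasurable
/-! ### The path functionals -/

section Functionals

variable (κ : ℝ≥0) {A : Set ℂ} (hA : IsStarHull A) (hne : A.Nonempty)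

/-- **The alive functional along a path**: `aliveFn` of `SLERestrictionAlive` for the family of
drivers `υ ↦ drvK κ υ` on path space. [folklore] -/
def RFnK (t : ℝ≥0) (υ : C(ℝ≥0, ℝ)) : ℝ := aliveFn (denseSeq hA hne) (fun υ : C(ℝ≥0, ℝ) ↦ drvK κ υ) t υ

/-- **`Φ'_{A_t - W_t}(0) · 𝟙{alive}` along a path.** [folklore] -/
def DFnK (A : Set ℂ) (t : ℝ≥0) (υ : C(ℝ≥0, ℝ)) : ℝ :=
  {υ : C(ℝ≥0, ℝ) | Disjoint (closedHull (drvK κ υ) t) A}.indicator (fun υ ↦ starDeriv (slidHull (drvK κ υ) A t)) υ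

/-- **The continuous modification** `D̂ⁿ = min (Φ' 𝟙{alive}) (n · R)`. [folklore] -/
def DhatFnK (n : ℕ) (t : ℝ≥0) (υ : C(ℝ≥0, ℝ)) : ℝ := min (DFnK κ A t υ) (n * RFnK κ hA hne t υ)

variable {κ hA hne}

/-- `0 ≤ R ≤ 1`. [folklore] -/
theorem RFnK_nonneg (t : ℝ≥0) (υ : C(ℝ≥0, ℝ)) : 0 ≤ RFnK κ hA hne t υ := aliveFn_nonneg _ _ t υ

/-- `R > 0` exactly at the alive times. [folklore] -/
theorem RFnK_pos_iff (t : ℝ≥0) (υ : C(ℝ≥0, ℝ)) : 0 < RFnK κ hA hne t υ ↔ Disjoint (closedHull (drvK κ υ) t) A :=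
  (disjoint_closedHull_iff_aliveFn_pos (W := fun υ : C(ℝ≥0, ℝ) ↦ drvK κ υ) (continuous_drvK κ υ) (drvK_zero κ υ) hA hne
    (denseSeq_spec hA hne).1 (denseSeq_spec hA hne).2).symm

/-- `0 ≤ D ≤ 1`, and `D = Φ'_{A_t - W_t}(0)` at alive times, `0` at dead times. [folklore] -/
theorem DFnK_eq (t : ℝ≥0) (υ : C(ℝ≥0, ℝ)) :
    (Disjoint (closedHull (drvK κ υ) t) A → DFnK κ A t υ = starDeriv (slidHull (drvK κ υ) A t)) ∧
      (¬ Disjoint (closedHull (drvK κ υ) t) A → DFnK κ A t υ = 0) ∧ 0 ≤ DFnK κ A t υ ∧ DFnK κ A t υ ≤ 1 := by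
  obtain ⟨h0, h1⟩ := starDeriv_pos_le_one (slidHull (drvK κ υ) A t)
  by_cases h : Disjoint (closedHull (drvK κ υ) t) A
  · have : DFnK κ A t υ = starDeriv (slidHull (drvK κ υ) A t) := by
      rw [DFnK, Set.indicator_of_mem]; exact h
    exact ⟨fun _ ↦ this, fun h' ↦ absurd h h', by rw [this]; exact h0.le, by rw [this]; exact h1⟩
  · have : DFnK κ A t υ = 0 := by
      rw [DFnK, Set.indicator_of_notMem]; exact h
    exact ⟨fun h' ↦ absurd h' h, fun _ ↦ this, by rw [this], by rw [this]; exact zero_le_one⟩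

/-- `0 ≤ D̂ ≤ 1`. [folklore] -/
theorem DhatFnK_mem_Icc (n : ℕ) (t : ℝ≥0) (υ : C(ℝ≥0, ℝ)) : DhatFnK κ hA hne n t υ ∈ Icc (0 : ℝ) 1 := by
  obtain ⟨-, -, h0, h1⟩ := DFnK_eq (κ := κ) (A := A) t υ
  have hR := RFnK_nonneg (κ := κ) (hA := hA) (hne := hne) t υ
  exact ⟨le_min h0 (by positivity), (min_le_left _ _).trans h1⟩

/-- **Where `R ≥ 1/n`, `D̂ⁿ = Φ'_{A_t - W_t}(0)`** (then alive, and `n R ≥ 1 ≥ Φ'`). [folklore] -/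
theorem DhatFnK_eq_starDeriv {n : ℕ} {t : ℝ≥0} {υ : C(ℝ≥0, ℝ)} (hn : 0 < n) (hR : 1 / (n : ℝ) ≤ RFnK κ hA hne t υ) :
    Disjoint (closedHull (drvK κ υ) t) A ∧ DhatFnK κ hA hne n t υ = starDeriv (slidHull (drvK κ υ) A t) := by
  have hn' : (0 : ℝ) < n := by exact_mod_cast hn
  have hRpos : 0 < RFnK κ hA hne t υ := lt_of_lt_of_le (by positivity) hR
  have halive := (RFnK_pos_iff t υ).1 hRpos
  obtain ⟨hD, -, -, hD1⟩ := DFnK_eq (κ := κ) (A := A) t υ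
  refine ⟨halive, ?_⟩
  rw [DhatFnK, hD halive, min_eq_left]
  have : 1 ≤ (n : ℝ) * RFnK κ hA hne t υ := by
    have := mul_le_mul_of_nonneg_left hR hn'.le
    rwa [mul_one_div_cancel hn'.ne'] at this
  rw [← hD halive]; exact hD1.trans this

/-! ### Continuity in time, for every path -/

/-- **`t ↦ R_t(υ)` is continuous for every path.** [folklore] -/
theorem continuous_RFnK (υ : C(ℝ≥0, ℝ)) : Continuous fun t ↦ RFnK κ hA hne t υ :=
  continuous_aliveFn (W := fun υ : C(ℝ≥0, ℝ) ↦ drvK κ υ) (continuous_drvK κ υ) (drvK_zero κ υ) hA hne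
    (denseSeq_spec hA hne).1 (denseSeq_spec hA hne).2

/-- **`t ↦ D̂ⁿ_t(υ)` is continuous for every path**: at alive times `D = Φ'` is continuous
(`continuousWithinAt_starDeriv_slidHull`, the alive times being open to the right) and so is `R`;
at dead times `0 ≤ D̂ⁿ ≤ n R → 0`. [folklore] -/
theorem continuous_DhatFnK (n : ℕ) (υ : C(ℝ≥0, ℝ)) : Continuous fun t ↦ DhatFnK κ hA hne n t υ := by
  have hW := continuous_drvK κ υ
  have hRc := continuous_RFnK (κ := κ) (hA := hA) (hne := hne) υ
  refine continuous_iff_continuousAt.2 fun t₀ ↦ ?_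
  by_cases h₀ : Disjoint (closedHull (drvK κ υ) t₀) A
  · -- alive: locally `D̂ = min Φ' (n R)`
    obtain ⟨t₁, ht₁, halive₁⟩ := exists_lt_disjoint (W := fun υ : C(ℝ≥0, ℝ) ↦ drvK κ υ) hW hA h₀
    have hnhds : Iio t₁ ∈ 𝓝 t₀ := Iio_mem_nhds ht₁
    have hsub : Iio t₁ ⊆ {v | Disjoint (closedHull (drvK κ υ) v) A} := fun v hv ↦ alive_mono (le_of_lt hv) halive₁
    have hd : ContinuousAt (fun v : ℝ≥0 ↦ starDeriv (slidHull (drvK κ υ) A v)) t₀ :=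
      (continuousWithinAt_starDeriv_slidHull hW hA hne h₀).continuousAt (Filter.mem_of_superset hnhds hsub)
    have heq : (fun t ↦ DhatFnK κ hA hne n t υ) =ᶠ[𝓝 t₀] fun t ↦ min (starDeriv (slidHull (drvK κ υ) A t)) (n * RFnK κ hA hne t υ) := by
      filter_upwards [hnhds] with t ht
      rw [DhatFnK, (DFnK_eq (A := A) t υ).1 (hsub ht)]
    have hR' : ContinuousAt (fun t ↦ (n : ℝ) * RFnK κ hA hne t υ) t₀ := (continuous_const.mul hRc).continuousAt
    have hmin : ContinuousAt (fun t ↦ min (starDeriv (slidHull (drvK κ υ) A t)) ((n : ℝ) * RFnK κ hA hne t υ)) t₀ :=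
      (Filter.Tendsto.min hd hR' :)
    exact hmin.congr_of_eventuallyEq heq
  · -- dead: `D̂ t₀ = 0` and `0 ≤ D̂ ≤ n R → n R t₀ = 0`
    have hR0 : RFnK κ hA hne t₀ υ = 0 :=
      aliveFn_eq_zero_of_not_disjoint (W := fun υ : C(ℝ≥0, ℝ) ↦ drvK κ υ) hW (drvK_zero κ υ) hA (denseSeq_spec hA hne).2
        (fun k ↦ ((denseSeq_spec hA hne).1 k).2) h₀
    have hD0 : DhatFnK κ hA hne n t₀ υ = 0 := by
      rw [DhatFnK, (DFnK_eq (A := A) t₀ υ).2.1 h₀, hR0, mul_zero, min_self]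
    rw [ContinuousAt, hD0]
    have hup : Tendsto (fun t ↦ (n : ℝ) * RFnK κ hA hne t υ) (𝓝 t₀) (𝓝 0) := by
      have h1 : ContinuousAt (fun t ↦ (n : ℝ) * RFnK κ hA hne t υ) t₀ := (continuous_const.mul hRc).continuousAt
      have h2 : (n : ℝ) * RFnK κ hA hne t₀ υ = 0 := by rw [hR0, mul_zero]
      rw [ContinuousAt, h2] at h1
      exact h1
    refine squeeze_zero (fun t ↦ (DhatFnK_mem_Icc n t υ).1) (fun t ↦ min_le_right _ _) hup

end Functionals


/-! ### Measurability of the functionals on path space -/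

section PathMeasurable

variable [MeasurableSpace C(ℝ≥0, ℝ)] [BorelSpace C(ℝ≥0, ℝ)] {κ : ℝ≥0} {A : Set ℂ} (hA : IsStarHull A) (hne : A.Nonempty)

/-- `R_t` is a measurable functional of the path. [folklore] -/
theorem measurable_RFnK (t : ℝ≥0) : Measurable (RFnK κ hA hne t) :=
  measurable_aliveFn (W := fun υ : C(ℝ≥0, ℝ) ↦ drvK κ υ) (fun υ ↦ continuous_drvK κ υ) (fun s _ ↦ measurable_drvK_apply κ s)
    fun k ↦ ((denseSeq_spec hA hne).1 k).2

include hA hne in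
/-- `D_t` is a measurable functional of the path. [folklore] -/
theorem measurable_DFnK (t : ℝ≥0) : Measurable (DFnK κ A t) :=
  measurable_indicator_starDeriv_slidHull (W := fun υ : C(ℝ≥0, ℝ) ↦ drvK κ υ) (fun υ ↦ continuous_drvK κ υ) (drvK_zero κ)
    (fun s _ ↦ measurable_drvK_apply κ s) hA hne

/-- `D̂ⁿ_t` is a measurable functional of the path. [folklore] -/
theorem measurable_DhatFnK (n : ℕ) (t : ℝ≥0) : Measurable (DhatFnK κ hA hne n t) :=
  (measurable_DFnK hA hne t).min (measurable_const.mul (measurable_RFnK hA hne t))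

end PathMeasurable

/-! ### The processes on the Wiener space: adaptedness, continuity, localisation -/

section Processes

variable (κ : ℝ≥0) {A : Set ℂ} (hA : IsStarHull A) (hne : A.Nonempty)

/-- The alive process `R_t(ω) = RFn_t(β(ω))`. [folklore] -/
def RpK (t : ℝ≥0) (ω : ℝ≥0 → ℝ) : ℝ := RFnK κ hA hne t (brownianCPath ω)

/-- The continuous modification `D̂ⁿ_t(ω)` of `Φ'_{A_t - W_t}(0)`. [folklore] -/
def DhatpK (n : ℕ) (t : ℝ≥0) (ω : ℝ≥0 → ℝ) : ℝ := DhatFnK κ hA hne n t (brownianCPath ω)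

variable {κ hA hne}

/-- The driver values of the Brownian path at times `≤ t` are `𝓕_t`-measurable. [folklore] -/
theorem measurable_drvK_brownianCPath_of_le {s t : ℝ≥0} (hs : s ≤ t) :
    Measurable[brownianFiltration t] fun ω ↦ drvK κ (brownianCPath ω) s := by
  have h1 : Measurable[brownianFiltration t] (brownian s) := (adapted_brownian s).mono (brownianFiltration.mono hs) le_rfl
  have h0 : Measurable[brownianFiltration t] (brownian 0) := (adapted_brownian 0).mono (brownianFiltration.mono bot_le) le_rfl
  exact measurable_const.mul (h1.sub h0)

/-- **`R` is adapted** to the Brownian filtration. [folklore] -/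
theorem adapted_RpK : Adapted brownianFiltration (RpK κ hA hne) := fun t ↦
  measurable_aliveFn (mΩ := brownianFiltration t) (W := fun ω : ℝ≥0 → ℝ ↦ drvK κ (brownianCPath ω))
    (fun _ ↦ continuous_drvK κ _) (fun _ hs ↦ measurable_drvK_brownianCPath_of_le hs) fun k ↦ ((denseSeq_spec hA hne).1 k).2

/-- **`D̂ⁿ` is adapted** to the Brownian filtration. [folklore] -/
theorem adapted_DhatpK (n : ℕ) : Adapted brownianFiltration (DhatpK κ hA hne n) := fun t ↦ by
  have hD : Measurable[brownianFiltration t] fun ω ↦ DFnK κ A t (brownianCPath ω) :=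
    measurable_indicator_starDeriv_slidHull (mΩ := brownianFiltration t) (W := fun ω : ℝ≥0 → ℝ ↦ drvK κ (brownianCPath ω))
      (fun _ ↦ continuous_drvK κ _) (fun _ ↦ drvK_zero κ _) (fun _ hs ↦ measurable_drvK_brownianCPath_of_le hs) hA hne
  exact hD.min (measurable_const.mul (adapted_RpK (κ := κ) t))

/-- The paths of `R` and `D̂ⁿ` are continuous. [folklore] -/
theorem continuous_RpK_DhatpK (n : ℕ) (ω : ℝ≥0 → ℝ) :
    Continuous (fun t ↦ RpK κ hA hne t ω) ∧ Continuous (fun t ↦ DhatpK κ hA hne n t ω) :=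
  ⟨continuous_RFnK _, continuous_DhatFnK n _⟩

variable (κ hA hne) in
/-- **The localising time** `Tₙ = Sₙ ∧ T²ₙ ∧ (n+1)`, `Sₙ = inf{t : R_t ≤ cₙ}`,
`T²ₙ = inf{t : D̂ⁿ⁺¹_t ≤ cₙ}`. [cite: LawlerSchrammWerner2003Restriction, §5 (Y_t, t < T, a local martingale)] -/
def locTimeK (n : ℕ) (ω : ℝ≥0 → ℝ) : WithTop ℝ≥0 :=
  min (min (hittingAfter (RpK κ hA hne) (Iic (locLevel n)) 0 ω) (hittingAfter (DhatpK κ hA hne (n + 1)) (Iic (locLevel n)) 0 ω))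
    (((n : ℝ≥0) + 1 : ℝ≥0) : WithTop ℝ≥0)

/-- **`Tₙ` is a stopping time** of the Brownian filtration (hitting times of closed sets by continuous
adapted processes). [folklore] -/
theorem isStoppingTime_locTimeK (n : ℕ) : IsStoppingTime brownianFiltration (locTimeK κ hA hne n) := by
  refine IsStoppingTime.min (IsStoppingTime.min ?_ ?_) (isStoppingTime_const _ _)
  · exact Process.isStoppingTime_hittingAfter_of_continuous adapted_RpK (fun ω ↦ (continuous_RpK_DhatpK 0 ω).1) isClosed_Iic
  · exact Process.isStoppingTime_hittingAfter_of_continuous (adapted_DhatpK (n + 1))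
      (fun ω ↦ (continuous_RpK_DhatpK (n + 1) ω).2) isClosed_Iic

/-- `Tₙ ≤ n + 1`. [folklore] -/
theorem locTimeK_le (n : ℕ) (ω : ℝ≥0 → ℝ) : locTimeK κ hA hne n ω ≤ (((n : ℝ≥0) + 1 : ℝ≥0) : WithTop ℝ≥0) :=
  min_le_right _ _

/-- **Before `Tₙ` the slid hull is in the controlled class**: alive, `D̂ⁿ⁺¹_t = Φ'_{A_t - W_t}(0) > cₙ`,
`R_t > cₙ`, and `dist(0, A_t - W_t) > cₙ`. [folklore] -/
theorem controlled_of_lt_locTimeK {n : ℕ} {t : ℝ≥0} {ω : ℝ≥0 → ℝ} (ht : (t : WithTop ℝ≥0) < locTimeK κ hA hne n ω) :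
    Disjoint (closedHull (drvK κ (brownianCPath ω)) t) A ∧ locLevel n < RpK κ hA hne t ω ∧
      DhatpK κ hA hne (n + 1) t ω = starDeriv (slidHull (drvK κ (brownianCPath ω)) A t) ∧
      locLevel n < starDeriv (slidHull (drvK κ (brownianCPath ω)) A t) ∧
      locLevel n < infDist 0 (slidHull (drvK κ (brownianCPath ω)) A t) := by
  obtain ⟨hc0, hc1⟩ := locLevel_pos_le n
  have h1 : (t : WithTop ℝ≥0) < hittingAfter (RpK κ hA hne) (Iic (locLevel n)) 0 ω :=
    lt_of_lt_of_le ht ((min_le_left _ _).trans (min_le_left _ _))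
  have h2 : (t : WithTop ℝ≥0) < hittingAfter (DhatpK κ hA hne (n + 1)) (Iic (locLevel n)) 0 ω :=
    lt_of_lt_of_le ht ((min_le_left _ _).trans (min_le_right _ _))
  have hR : locLevel n < RpK κ hA hne t ω := not_le.1 (Process.notMem_of_coe_lt_hittingAfter_zero h1)
  have hD : locLevel n < DhatpK κ hA hne (n + 1) t ω := not_le.1 (Process.notMem_of_coe_lt_hittingAfter_zero h2)
  have hR' : 1 / ((n + 1 : ℕ) : ℝ) ≤ RFnK κ hA hne t (brownianCPath ω) := by
    rw [Nat.cast_add, Nat.cast_one]; exact hR.le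
  obtain ⟨halive, hDeq⟩ := DhatFnK_eq_starDeriv (hA := hA) (hne := hne) (Nat.succ_pos n) hR'
  refine ⟨halive, hR, hDeq, by rw [← hDeq]; exact hD, ?_⟩
  -- `R_t = min (min_{[0,t]} m) 1 ≤ m_t`
  have hsp := denseSeq_spec hA hne
  have := aliveFn_le_min_infDist (W := fun υ : C(ℝ≥0, ℝ) ↦ drvK κ υ) (continuous_drvK κ _) hA hsp.1 hsp.2 le_rfl halive
  exact lt_of_lt_of_le hR (this.trans (min_le_left _ _))

/-- Time `0` is alive (`0 ∉ A`). [folklore] -/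
theorem disjoint_closedHull_zeroK (hA : IsStarHull A) (υ : C(ℝ≥0, ℝ)) : Disjoint (closedHull (drvK κ υ) 0) A := by
  rw [Set.disjoint_left]
  intro z hz hzA
  have hT : swallowingTime (drvK κ υ) z ≤ ((0 : ℝ≥0) : WithTop ℝ≥0) := hz.2
  have hz0 : z ≠ drvK κ υ 0 := by
    rw [drvK_zero κ]; intro h
    exact hA.zero_notMem (by rw [Complex.ofReal_zero] at h; rwa [← h])
  have := swallowingTime_pos_holds (continuous_drvK κ υ) hz0
  exact absurd (lt_of_lt_of_le this hT) (lt_irrefl _)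

end Processes

end Literature.Probability.RandomPlanarGeometry
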